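import Mathlib
import Summits.MatrixMultiplication.MatrixMultiplication.Theses.SuccinctSecantEquations

/-!
# `SuccinctSecantEquations.SuccinctSeparation` (stmt-MatrixMultiplication-7986) — the STRATEGIST'S SPLIT
# `SuccinctSeparationBeyondConstants → SuccinctSeparationProductLaw → SuccinctSeparation`

Notation.  `N = n²`; a *succinct separation at `(n, r, s)`* is a polynomial `F` on
`ℂ^{N} ⊗ ℂ^{N} ⊗ ℂ^{N}` (variables indexed by `(Fin n × Fin n)³`) of fan-in-two circuit size
`complexity F ≤ s` that vanishes on every tensor of rank `≤ r` (hence on the secant variety `σ_r`) and does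
not vanish at the matrix multiplication tensor `⟨n,n,n⟩` (so `bR(⟨n,n,n⟩) > r`, certified by a small circuit).
The crux `SuccinctSeparation` (X) asks for `δ > 0`, `C` and infinitely many `n` with a succinct separation at
`(n, r, n^C)` for some `r ≥ n^{2+δ}` — a SUCCINCTLY CERTIFIED superquadratic border-rank lower bound (it implies
`ω(ℂ) > 2`, route glue `closes`).  Two named statements, NEITHER of which is known to imply `ω(ℂ) ≠ 2` or to
follow from it, and neither of which is X reworded:

* `X₁` = SUCCINCT SEPARATION BEYOND CONSTANTS (first hypothesis): one size exponent `a` serves every constant —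
  `∃ a ∀ K ∃ n ≥ K ∃ r ≥ K·n², succinct separation at (n, r, n^a)`.  Rank content: `sup_n bR(⟨n,n,n⟩)/n² = ∞`
  (open even non-constructively: record `2n² − ⌈log₂ n⌉ − 1`, LandsbergMichalek2018), consistent with
  `ω(ℂ) = 2`; equation content: for `K ≥ 6` the level `K n² > 6N − 4` is beyond every LINEAR rank method
  (cactus barrier, Buczynski2026) — the route's rung `BeyondCactusSuccinctEquations` evaluated AT `⟨n,n,n⟩`.
  Implied by X (take `a = C`, `n` large with `n^δ ≥ K`).
* `X₂` = SUCCINCT SEPARATION PRODUCT LAW (second hypothesis): along `⟨nm,nm,nm⟩ ≅ ⟨n,n,n⟩ ⊠ ⟨m,m,m⟩`, succinct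
  separations TENSORISE up to a constant factor `1/k` in the level and a bilinear loss in circuit size —
  `∀ a ∃ k > 0 ∃ A ∀ n m ≥ 2 ∀ r ≥ n² ∀ r' ≥ m²`, separations at `(n, r, ≤ n^a)` and `(m, r', ≤ m^a)` give one at
  `(n·m, ⌊r r'/k⌋, ≤ max(A·s·s', (nm)^a))` (bilinear in the factors' sizes, or within the same format
  exponent).  Flattening minors tensorise exactly (Kronecker products), Koszul flattenings do not; border
  rank is strictly submultiplicative in general (arXiv:1801.04852) and already at `⟨2⟩ ⊠ ⟨2⟩`
  (`bR(⟨2,2,2⟩)² = 49 > 48 ≥ R(⟨4,4,4⟩)`, DumasPernetSedoglavic2025), so the constant `k` absorbs what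
  multiplicativity of `bR` cannot give (whether `k = 1` fails for CERTIFIED levels is open even at `n = m = 2`:
  it needs `bR(⟨4,4,4⟩) ≤ 36`; known `29 ≤ bR(⟨4,4,4⟩) ≤ 48`); an irregular
  succinct-separation profile `K(n)·n²` with `K → ∞` sub-polynomially would make `X₁` true and `X₂`, X false.
  Not implied by X and does not imply it (no seed).

THEOREM (`SuccinctSeparation_of_subs`): `X₁ → X₂ → SuccinctSeparation`, with witnesses `δ = log_{n₀} 2`,
`C = a + 1` read off ONE seed.  Proof (Fekete iteration, no polynomial algebra — the separating polynomial is
carried existentially): `a` from `X₁`; `(k, A)` from `X₂` at exponent `a+1`; seed from `X₁` at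
`K = 3k + A + 2`: `n₀ ≥ K ≥ 2`, `A ≤ n₀`, `r₀ ≥ K n₀² ≥ 3k·n₀²` so `⌊r₀/k⌋ ≥ 3n₀²`.  ITERATION (`split_iter`)
along `n₀^{j+2} = n₀^{j+1}·n₀`: a separation at `(n₀^{j+1}, R_j, ≤ (n₀^{j+1})^{a+1})` with `R_j ≥ (3n₀²)^{j+1}`
(`R_{j+1} = ⌊R_j r₀/k⌋ ≥ R_j·⌊r₀/k⌋`; size `A·(n₀^{j+1})^{a+1}·n₀^a ≤ (n₀^{j+2})^{a+1}` because `A ≤ n₀`,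
or directly `≤ (n₀^{j+1} n₀)^{a+1}`; the
guards `n² ≤ r` hold since `(n₀^{j+1})² ≤ (3n₀²)^{j+1}`; the format `Fin (n₀^{j+1}·n₀)` is transported to
`Fin (n₀^{j+2})` along `pow_succ`, `split_transport`).  Finally `(n₀^{j+1})^{2+δ} = (2n₀²)^{j+1} ≤ (3n₀²)^{j+1}
≤ R_j` (`n₀^δ = 2`, `Real.rpow_logb`) and `N₀ ≤ 2^{N₀} ≤ n₀^{N₀+1}`.  What the split isolates: `X₁` is the
succinct-lower-bound content AT THE FORMAT-LINEAR WALL (first open rung `K = 2`), `X₂` the CROSS-SCALE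
REGULARITY content (the rate upgrade from "unbounded ratio" to "power").
Supports item `stmt-MatrixMultiplication-7986`; Mathlib + the route file only; no definitions, no named facts.
-/

set_option linter.dupNamespace false

noncomputable section

namespace Summit.MatrixMultiplication.MatrixMultiplication.Theorems.SuccinctSeparation

open Literature.Computability.AlgebraicComplexity
open Summit.MatrixMultiplication.MatrixMultiplication.Theses.SuccinctSecantEquations (SuccinctSeparation)

/-- Polynomials on `ℂ^{n²} ⊗ ℂ^{n²} ⊗ ℂ^{n²}` (the format of `⟨n,n,n⟩`). -/
local notation "Poly[" n "]" =>
  MvPolynomial ((Fin n × Fin n) × (Fin n × Fin n) × (Fin n × Fin n)) ℂ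

set_option quotPrecheck false in
/-- `F` vanishes on every tensor of rank `≤ r` of format `(Fin n × Fin n)³`. -/
local notation "Vanish[" n ", " r ", " F "]" =>
  ∀ T : Fin n × Fin n → Fin n × Fin n → Fin n × Fin n → ℂ, tensorRank T ≤ r →
    MvPolynomial.eval (fun p => T p.1 p.2.1 p.2.2) F = 0

set_option quotPrecheck false in
/-- `F` does not vanish at the matrix multiplication tensor `⟨n,n,n⟩`. -/
local notation "AtMM[" n ", " F "]" =>
  MvPolynomial.eval (fun p => matMulTensor ℂ n n n p.1 p.2.1 p.2.2) F ≠ 0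

/-! ## Transport of a succinct separation along an equality of formats -/

/-- A succinct separation at `(n, r, s)` is one at `(n', r, s')` whenever `n = n'` and `s ≤ s'`
(the variable type `(Fin n × Fin n)³` depends on `n`, so the format is moved by `subst`). [folklore] -/
theorem split_transport {n n' : ℕ} (h : n = n') {r s s' : ℕ} (hs : s ≤ s')
    (hsep : ∃ F : Poly[n], complexity F ≤ s ∧ Vanish[n, r, F] ∧ AtMM[n, F]) :
    ∃ F : Poly[n'], complexity F ≤ s' ∧ Vanish[n', r, F] ∧ AtMM[n', F] := by
  subst h
  obtain ⟨F, hc, hv, hm⟩ := hsep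
  exact ⟨F, hc.trans hs, hv, hm⟩

/-! ## The Fekete iteration along `n₀^{j+2} = n₀^{j+1} · n₀` -/

/-- FEKETE ITERATION.  From a seed separation at `(n₀, r₀, ≤ n₀^a)` with `n₀ ≥ 2`, `A ≤ n₀`,
`3·n₀²·k ≤ r₀`, and the product law at exponent `a+1` with constants `(k, A)`, every level `j` carries a
succinct separation at `(n₀^{j+1}, R, ≤ (n₀^{j+1})^{a+1})` with `(3n₀²)^{j+1} ≤ R`. [folklore] -/
theorem split_iter (n₀ r₀ k A a : ℕ) (hn₀ : 2 ≤ n₀) (hA : A ≤ n₀) (hk : 0 < k)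
    (hr₀ : 3 * n₀ ^ 2 * k ≤ r₀)
    (hseed : ∃ F : Poly[n₀], complexity F ≤ n₀ ^ a ∧ Vanish[n₀, r₀, F] ∧ AtMM[n₀, F])
    (hlaw : ∀ (n m r r' : ℕ) (F : Poly[n]) (F' : Poly[m]), 2 ≤ n → 2 ≤ m → n ^ 2 ≤ r → m ^ 2 ≤ r' →
      complexity F ≤ n ^ (a + 1) → complexity F' ≤ m ^ (a + 1) →
      Vanish[n, r, F] → AtMM[n, F] → Vanish[m, r', F'] → AtMM[m, F'] →
      ∃ G : Poly[n * m], complexity G ≤ max (A * complexity F * complexity F') ((n * m) ^ (a + 1)) ∧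
        Vanish[n * m, r * r' / k, G] ∧ AtMM[n * m, G])
    (j : ℕ) :
    ∃ R : ℕ, (3 * n₀ ^ 2) ^ (j + 1) ≤ R ∧
      ∃ G : Poly[n₀ ^ (j + 1)], complexity G ≤ (n₀ ^ (j + 1)) ^ (a + 1) ∧
        Vanish[n₀ ^ (j + 1), R, G] ∧ AtMM[n₀ ^ (j + 1), G] := by
  have h1 : 1 ≤ n₀ := le_trans (by norm_num) hn₀
  have hsq : n₀ ^ 2 ≤ 3 * n₀ ^ 2 * k := by
    calc n₀ ^ 2 = 1 * n₀ ^ 2 * 1 := by ring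
      _ ≤ 3 * n₀ ^ 2 * k := Nat.mul_le_mul (Nat.mul_le_mul (by norm_num) le_rfl) hk
  have hr₀' : n₀ ^ 2 ≤ r₀ := hsq.trans hr₀
  have hdiv : 3 * n₀ ^ 2 ≤ r₀ / k := (Nat.le_div_iff_mul_le hk).2 hr₀
  obtain ⟨F₀, hF₀c, hF₀v, hF₀m⟩ := hseed
  have hF₀c' : complexity F₀ ≤ n₀ ^ (a + 1) :=
    hF₀c.trans (Nat.pow_le_pow_right h1 (Nat.le_succ a))
  induction j with
  | zero =>
    refine ⟨r₀, ?_, ?_⟩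
    · calc (3 * n₀ ^ 2) ^ (0 + 1) = 3 * n₀ ^ 2 * 1 := by ring
        _ ≤ 3 * n₀ ^ 2 * k := Nat.mul_le_mul_left _ hk
        _ ≤ r₀ := hr₀
    · refine split_transport (pow_one n₀).symm ?_ ⟨F₀, hF₀c, hF₀v, hF₀m⟩
      rw [zero_add, pow_one]
      exact Nat.pow_le_pow_right h1 (Nat.le_succ a)
  | succ j ih =>
    obtain ⟨R, hR, G, hGc, hGv, hGm⟩ := ih
    -- guards for the law at (n₀^{j+1}, R) ⊠ (n₀, r₀)
    have hn : 2 ≤ n₀ ^ (j + 1) := le_trans hn₀ (Nat.le_self_pow (Nat.succ_ne_zero j) n₀)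
    have hRsq : (n₀ ^ (j + 1)) ^ 2 ≤ R := by
      calc (n₀ ^ (j + 1)) ^ 2 = (n₀ ^ 2) ^ (j + 1) := by rw [← pow_mul, ← pow_mul, mul_comm]
        _ ≤ (3 * n₀ ^ 2) ^ (j + 1) := Nat.pow_le_pow_left (by omega) _
        _ ≤ R := hR
    obtain ⟨G', hG'c, hG'v, hG'm⟩ :=
      hlaw (n₀ ^ (j + 1)) n₀ R r₀ G F₀ hn hn₀ hRsq hr₀' hGc hF₀c' hGv hGm hF₀v hF₀m
    refine ⟨R * r₀ / k, ?_, ?_⟩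
    · -- level: (3n₀²)^{j+2} = (3n₀²)^{j+1}·(3n₀²) ≤ R·⌊r₀/k⌋ ≤ ⌊R r₀/k⌋
      calc (3 * n₀ ^ 2) ^ (j + 1 + 1) = (3 * n₀ ^ 2) ^ (j + 1) * (3 * n₀ ^ 2) := pow_succ _ _
        _ ≤ R * (r₀ / k) := Nat.mul_le_mul hR hdiv
        _ ≤ R * r₀ / k := Nat.mul_div_le_mul_div_assoc R r₀ k
    · -- size: A·(n₀^{j+1})^{a+1}·n₀^a ≤ (n₀^{j+1})^{a+1}·n₀^{a+1} = (n₀^{j+2})^{a+1}, using A ≤ n₀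
      refine split_transport (pow_succ n₀ (j + 1)).symm ?_ ⟨G', hG'c, hG'v, hG'm⟩
      refine max_le ?_ (by rw [← pow_succ])
      calc A * complexity G * complexity F₀
          ≤ n₀ * (n₀ ^ (j + 1)) ^ (a + 1) * n₀ ^ a :=
            Nat.mul_le_mul (Nat.mul_le_mul hA hGc) hF₀c
        _ = (n₀ ^ (j + 1) * n₀) ^ (a + 1) := by ring
        _ = (n₀ ^ (j + 1 + 1)) ^ (a + 1) := by rw [← pow_succ]

/-! ## The split -/

/-- **The strategist's split of `SuccinctSeparation`** (BC2 redirect of the RESTATED deciding crux of route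
`SuccinctSecantEquations`): SUCCINCT SEPARATION BEYOND CONSTANTS (`∃ a ∀ K ∃ n ≥ K ∃ r ≥ K n²`, a size-`n^a`
polynomial vanishing on all tensors of rank `≤ r` and not at `⟨n,n,n⟩`) and the SUCCINCT SEPARATION PRODUCT
LAW (such separations tensorise along `⟨nm⟩ = ⟨n⟩ ⊠ ⟨m⟩` with level `⌊r r'/k⌋` and size
`≤ max(A·s·s', (nm)^a)`) together
imply `SuccinctSeparation` with `δ = log_{n₀} 2`, `C = a + 1`: Fekete iteration `split_iter` along the powers
of one seed size `n₀`, then `(n₀^{j+1})^{2+δ} = (2n₀²)^{j+1} ≤ (3n₀²)^{j+1}`.  The two hypotheses are the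
children `SuccinctSeparationBeyondConstants`, `SuccinctSeparationProductLaw` verbatim. [folklore] -/
theorem SuccinctSeparation_of_subs
    (h₁ : ∃ a : ℕ, ∀ K : ℕ, ∃ n r : ℕ, K ≤ n ∧ K * n ^ 2 ≤ r ∧
      ∃ F : MvPolynomial ((Fin n × Fin n) × (Fin n × Fin n) × (Fin n × Fin n)) ℂ,
        Literature.Computability.AlgebraicComplexity.complexity F ≤ n ^ a ∧
        (∀ T : Fin n × Fin n → Fin n × Fin n → Fin n × Fin n → ℂ,
          Literature.Computability.AlgebraicComplexity.tensorRank T ≤ r →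
            MvPolynomial.eval (fun p => T p.1 p.2.1 p.2.2) F = 0) ∧
        MvPolynomial.eval (fun p =>
          Literature.Computability.AlgebraicComplexity.matMulTensor ℂ n n n p.1 p.2.1 p.2.2) F ≠ 0)
    (h₂ : ∀ a : ℕ, ∃ k : ℕ, 0 < k ∧ ∃ A : ℕ, ∀ (n m r r' : ℕ)
      (F : MvPolynomial ((Fin n × Fin n) × (Fin n × Fin n) × (Fin n × Fin n)) ℂ)
      (F' : MvPolynomial ((Fin m × Fin m) × (Fin m × Fin m) × (Fin m × Fin m)) ℂ),
      2 ≤ n → 2 ≤ m → n ^ 2 ≤ r → m ^ 2 ≤ r' →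
      Literature.Computability.AlgebraicComplexity.complexity F ≤ n ^ a →
      Literature.Computability.AlgebraicComplexity.complexity F' ≤ m ^ a →
      (∀ T : Fin n × Fin n → Fin n × Fin n → Fin n × Fin n → ℂ,
        Literature.Computability.AlgebraicComplexity.tensorRank T ≤ r →
          MvPolynomial.eval (fun p => T p.1 p.2.1 p.2.2) F = 0) →
      MvPolynomial.eval (fun p =>
        Literature.Computability.AlgebraicComplexity.matMulTensor ℂ n n n p.1 p.2.1 p.2.2) F ≠ 0 →
      (∀ T : Fin m × Fin m → Fin m × Fin m → Fin m × Fin m → ℂ,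
        Literature.Computability.AlgebraicComplexity.tensorRank T ≤ r' →
          MvPolynomial.eval (fun p => T p.1 p.2.1 p.2.2) F' = 0) →
      MvPolynomial.eval (fun p =>
        Literature.Computability.AlgebraicComplexity.matMulTensor ℂ m m m p.1 p.2.1 p.2.2) F' ≠ 0 →
      ∃ G : MvPolynomial ((Fin (n * m) × Fin (n * m)) × (Fin (n * m) × Fin (n * m)) ×
          (Fin (n * m) × Fin (n * m))) ℂ,
        Literature.Computability.AlgebraicComplexity.complexity G ≤
            max (A * Literature.Computability.AlgebraicComplexity.complexity F *
              Literature.Computability.AlgebraicComplexity.complexity F') ((n * m) ^ a) ∧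
        (∀ T : Fin (n * m) × Fin (n * m) → Fin (n * m) × Fin (n * m) → Fin (n * m) × Fin (n * m) → ℂ,
          Literature.Computability.AlgebraicComplexity.tensorRank T ≤ r * r' / k →
            MvPolynomial.eval (fun p => T p.1 p.2.1 p.2.2) G = 0) ∧
        MvPolynomial.eval (fun p =>
          Literature.Computability.AlgebraicComplexity.matMulTensor ℂ (n * m) (n * m) (n * m)
            p.1 p.2.1 p.2.2) G ≠ 0) :
    SuccinctSeparation := by
  -- (i) constants: `a` from the seed statement, `(k, A)` from the law at exponent `a + 1`, one seed at
  -- `K = 3k + A + 2` (so `n₀ ≥ 2`, `A ≤ n₀`, `3k·n₀² ≤ r₀`).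
  obtain ⟨a, hseed⟩ := h₁
  obtain ⟨k, hk, A, hlaw⟩ := h₂ (a + 1)
  obtain ⟨n₀, r₀, hKn, hKr, F₀, hF₀c, hF₀v, hF₀m⟩ := hseed (3 * k + A + 2)
  have hn₀ : 2 ≤ n₀ := by omega
  have hA : A ≤ n₀ := by omega
  have hr₀ : 3 * n₀ ^ 2 * k ≤ r₀ := by
    calc 3 * n₀ ^ 2 * k = (3 * k) * n₀ ^ 2 := by ring
      _ ≤ (3 * k + A + 2) * n₀ ^ 2 := Nat.mul_le_mul_right _ (by omega)
      _ ≤ r₀ := hKr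
  -- (ii) the real exponent: `δ = log_{n₀} 2 > 0`, `n₀^δ = 2`.
  have hn₀R : (1 : ℝ) < n₀ := by exact_mod_cast (lt_of_lt_of_le one_lt_two hn₀)
  have hn₀pos : (0 : ℝ) < n₀ := lt_trans one_pos hn₀R
  have hδpos : 0 < Real.logb n₀ 2 := Real.logb_pos hn₀R one_lt_two
  have hpowδ : (n₀ : ℝ) ^ Real.logb n₀ 2 = 2 := Real.rpow_logb hn₀pos (ne_of_gt hn₀R) two_pos
  refine ⟨Real.logb n₀ 2, hδpos, a + 1, fun N₀ => ?_⟩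
  -- (iii) level `N₀` of the Fekete iteration.
  obtain ⟨R, hR, G, hGc, hGv, hGm⟩ :=
    split_iter n₀ r₀ k A a hn₀ hA hk hr₀ ⟨F₀, hF₀c, hF₀v, hF₀m⟩ hlaw N₀
  refine ⟨n₀ ^ (N₀ + 1), ?_, R, ?_, G, hGc, hGv, hGm⟩
  · -- `N₀ ≤ 2^{N₀} ≤ n₀^{N₀} ≤ n₀^{N₀+1}`
    calc N₀ ≤ 2 ^ N₀ := Nat.lt_two_pow_self.le
      _ ≤ n₀ ^ N₀ := Nat.pow_le_pow_left hn₀ N₀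
      _ ≤ n₀ ^ (N₀ + 1) := Nat.pow_le_pow_right (by omega) (Nat.le_succ _)
  · -- `(n₀^{N₀+1})^{2+δ} = (n₀^{2+δ})^{N₀+1} = (2 n₀²)^{N₀+1} ≤ (3 n₀²)^{N₀+1} ≤ R`
    have h0 : (0 : ℝ) ≤ n₀ := hn₀pos.le
    have hbase : (n₀ : ℝ) ^ ((2 : ℝ) + Real.logb n₀ 2) = 2 * (n₀ : ℝ) ^ 2 := by
      rw [Real.rpow_add hn₀pos, hpowδ, Real.rpow_two]; ring
    have key : ((n₀ : ℝ) ^ (N₀ + 1)) ^ ((2 : ℝ) + Real.logb n₀ 2)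
        = (2 * (n₀ : ℝ) ^ 2) ^ (N₀ + 1) := by
      have e1 : ((n₀ : ℝ) ^ (N₀ + 1)) = (n₀ : ℝ) ^ ((N₀ + 1 : ℕ) : ℝ) :=
        (Real.rpow_natCast _ _).symm
      rw [e1, ← Real.rpow_mul h0, mul_comm, Real.rpow_mul h0, Real.rpow_natCast, hbase]
    push_cast
    rw [key]
    calc (2 * (n₀ : ℝ) ^ 2) ^ (N₀ + 1) ≤ (3 * (n₀ : ℝ) ^ 2) ^ (N₀ + 1) := by
          gcongr; norm_num
      _ ≤ (R : ℝ) := by exact_mod_cast hR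

end Summit.MatrixMultiplication.MatrixMultiplication.Theorems.SuccinctSeparation

end
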